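import Literature.NumberTheory.Rogawski1990.LocalStableClassesNonsplitKappa
import Literature.NumberTheory.Rogawski1990.SingularLocalConjugacy
import Literature.NumberTheory.Rogawski1990.FinExplicitTransferFactorScalarPartner
import Literature.NumberTheory.Rogawski1990.FinExplicitTransferFactorGHRegular
import Literature.NumberTheory.Rogawski1990.LocalStableClassesNonsplitKappaCount
import Literature.NumberTheory.Rogawski1990.ExplicitFactorKappaAlmostEverywhereOne
import HarnessLib

/-!
# `κ_v` at the SCALAR PARTNER `γ_H = (e·1₂, u)` separates the two `G′_v`-classes of its local stable class: `κ_v(γ_H, ε′) = −κ_v(γ_H, ε)`,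
# hence `Δ‴_v(γ_H, ε′) = −Δ‴_v(γ_H, ε)` (Rogawski 1990, §3.8 Prop. 3.8.1 (d), §4.3 (4.3.2), Prop. 8.2.1 (a)(d))

Topic `NumberTheory/Rogawski1990`; namespace `Literature.NumberTheory.Rogawski1990`.  **THEOREMS ONLY** (no definition, no named fact, no instance,
no notation, no `sorry`).  Cell `pub/hodgecm-mathlib`, programme P3a, road «N6nsGerm» (crux H413), brick (m2) = (K-s) «κ AT THE TWO SINGULAR MATCHING PAIRS»
of A-p16 (g26)'s census `CENSUS-N6nsGerm-S1` §2 ∕ binder B6 of F0P2-p02 (g8)'s junction census `CENSUS-N6nsS1-junction`: the SCALAR-BLOCK twin of ★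
`LocalStableClassesNonsplitTypeTwoKappa.finKappaAt_eq_iff_isConj` (type (2), `χ_A` irreducible).  Seat A-p17 (g21).  HONEST LABEL: HC_CM is proved only
modulo the printed citations until rung 0 closes; this file is unconditional local algebra.

THE PRINT.  At the singular semisimple `ε = ι(γ_H)`, `γ_H = (e·1₂, u)` (`u ≠ e`), the `G′_v`-classes inside the stable class are TWO at a non-split `v`
(`F_v^× ∕ N E_v^×`, [Rogawski1990, §3.8 Prop. 3.8.1 (d) p. 30; proof of Prop. 8.2.1: the classes `ε`, `ε′`]), told apart by the norm class of the rank-one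
block of the transported form — the relative position read by `κ_v(γ_H, ·)` [§4.3 (4.3.2) p. 43]; since `Δ‴_v = τ_v · D_v · κ_v` with `τ_v, D_v` functions of
`γ_H` alone, `Δ‴_v(γ_H, ε′) = −Δ‴_v(γ_H, ε)`.  PROOF: `ι_v(γ_H) = diag(e, u, e)` (★ `coe_endoGL_eq`), framed by the transposition `P₀ = (e₁ e₃ e₂)`:
`ι_v(γ_H) P₀ = P₀ (e·1₂ ⊕ᶠ u·1₁)`; for a match `γ′ = g ι(γ_H) g⁻¹`, `ι(γ_H)` is unitary for `H′_g` (★ `twistGram`), whose Gram matrix in the frame commutes with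
`e·1₂ ⊕ᶠ u·1₁` (`σ(e)e = σ(u)u = 1`) and is block diagonal `G₁ ⊕ᶠ G₂` (★ `eq_finSum_of_commute`) — §1; the sign reads on the `u`-column of `g P₀` (★
`finKappaAt_eq_ite_twistGram_eigenframe`: `κ_v = +1 ⟺ G₂` is a unit norm); equal signs ⟺ `G″₂ = N(z) G₂` (★ `exists_norm_mul_iff_norm_tests_iff`) ⟹
`det G″₁ = det G₁ · N(z′)` (★ `det_twistGram`, `det_finSum`) ⟹ conjugate (★ `SingularLocalConjugacy.exists_unitary_conj_of_det_blocks`) — §2.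

* §1 (ring-generic) **`exists_twistGram_eq_finSum_of_scalar_frame`**, `scalar_endoPattern_eq`, `exists_eq_mul_norm_of_mul_eq` (+ private matrix plumbing).
* §2 (CM carriers, binders VERBATIM ★ `LocalStableClassesNonsplitTypeTwoKappa` + the scalar-block hypothesis `ha : γ_H.1 = e • 1` of ★ `FinExplicitTransferFactorScalarPartner`)
  `conjLocal_mul_self_of_fst_eq_smul_one` (`σ(e) e = 1`), **`finKappaAt_eq_iff_isConj_of_fst_eq_smul_one`**, **`finKappaAt_eq_neg_of_not_isConj_of_fst_eq_smul_one`**,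
  **`finExplicitDelta_eq_neg_of_not_isConj_of_fst_eq_smul_one`**, `finExplicitCollection_Δ_eq_neg_of_not_isConj_of_fst_eq_smul_one`.

NOT here: the EXISTENCE of the second class (binder B2 of the junction; rank-3 classification).
## References
* [Rogawski1990] J. D. Rogawski, *Automorphic Representations of Unitary Groups in Three Variables*, Ann. of Math. Stud. 123 (1990), §3.1 p. 19, §3.5
  Prop. 3.5.2 (c) p. 29, §3.8 Prop. 3.8.1 (d) p. 30, §4.3 (4.3.2) p. 43, §4.9 p. 55, §8.2 Prop. 8.2.1 (a)(d) pp. 118–122.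
* [LanglandsShelstad1987] Langlands–Shelstad, *On the definition of transfer factors*, Math. Ann. 278 (1987), §1, §2. [Kottwitz1986] R. E. Kottwitz,
  *Stable trace formula: elliptic singular terms*, Math. Ann. 275 (1986), §7. [Jacobowitz1962] R. Jacobowitz, *Hermitian forms over local fields* (1962), §3 Thm. 3.1.
-/

set_option autoImplicit false

noncomputable section

open NumberField IsDedekindDomain Matrix
open scoped MatrixGroups

namespace Literature.NumberTheory.Rogawski1990

open Literature.NumberTheory.Automorphic Literature.NumberTheory.Automorphic.UnitaryGroup Literature.NumberTheory.GaloisRepresentations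
open Literature.AlgebraicGeometry.ShimuraVarieties (unitaryGroup mem_unitaryGroup_iff)

/-! ## §1 Ring-generic: the Gram matrix of a form preserved by a scalar-block element is block diagonal in the frame -/

section Generic

variable {S : Type*} [CommRing S] (σ : S →+* S) {N₁ N₂ : ℕ}

omit σ in
/-- `a·1 ⊕ᶠ b·1` is the diagonal matrix with entries `a` on the first block and `b` on the second. [folklore] -/
private theorem finSum_smul_one_eq_diagonal_elim (a b : S) :
    finSum N₁ N₂ (a • (1 : Matrix (Fin N₁) (Fin N₁) S)) (b • (1 : Matrix (Fin N₂) (Fin N₂) S)) =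
      diagonal (fun i => Sum.elim (fun _ => a) (fun _ => b) (finSumFinEquiv.symm i)) := by
  rw [finSum, smul_one_eq_diagonal, smul_one_eq_diagonal, fromBlocks_diagonal, reindex_apply, submatrix_diagonal_equiv]
  rfl

/-- `ᵗσ(a·1 ⊕ᶠ b·1) = σa·1 ⊕ᶠ σb·1`. [folklore] -/
private theorem map_transpose_finSum_smul_one (a b : S) :
    ((finSum N₁ N₂ (a • (1 : Matrix (Fin N₁) (Fin N₁) S)) (b • (1 : Matrix (Fin N₂) (Fin N₂) S))).map σ)ᵀ =
      finSum N₁ N₂ (σ a • (1 : Matrix (Fin N₁) (Fin N₁) S)) (σ b • (1 : Matrix (Fin N₂) (Fin N₂) S)) := by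
  rw [finSum_smul_one_eq_diagonal_elim, finSum_smul_one_eq_diagonal_elim, diagonal_map (map_zero σ), diagonal_transpose]
  congr 1
  funext i
  rcases finSumFinEquiv.symm i with j | j <;> rfl

omit σ in
/-- `(a·1 ⊕ᶠ b·1)(c·1 ⊕ᶠ d·1) = (ac)·1 ⊕ᶠ (bd)·1`. [folklore] -/
private theorem finSum_smul_one_mul_finSum_smul_one (a b c d : S) :
    finSum N₁ N₂ (a • (1 : Matrix (Fin N₁) (Fin N₁) S)) (b • (1 : Matrix (Fin N₂) (Fin N₂) S)) *
        finSum N₁ N₂ (c • (1 : Matrix (Fin N₁) (Fin N₁) S)) (d • (1 : Matrix (Fin N₂) (Fin N₂) S)) =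
      finSum N₁ N₂ ((a * c) • (1 : Matrix (Fin N₁) (Fin N₁) S)) ((b * d) • (1 : Matrix (Fin N₂) (Fin N₂) S)) := by
  simp only [finSum, Matrix.reindex_apply, Matrix.submatrix_mul_equiv, Matrix.fromBlocks_multiply, Matrix.mul_zero, Matrix.zero_mul,
    add_zero, zero_add, smul_mul_assoc, Matrix.one_mul, smul_smul]

omit σ in
/-- The `(inr i, inr j)` entry of `A ⊕ᶠ B` is `B i j`. [folklore] -/
private theorem finSum_apply_inr (A : Matrix (Fin N₁) (Fin N₁) S) (B : Matrix (Fin N₂) (Fin N₂) S) (i j : Fin N₂) :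
    finSum N₁ N₂ A B (finSumFinEquiv (Sum.inr i)) (finSumFinEquiv (Sum.inr j)) = B i j := by
  rw [finSum, reindex_apply, submatrix_apply, Equiv.symm_apply_apply, Equiv.symm_apply_apply, fromBlocks_apply₂₂]

/-- **THE GRAM MATRIX IN A SCALAR-BLOCK FRAME IS BLOCK DIAGONAL.** If `γ ∈ U(H)(S)` has the frame `γ P = P (e·1 ⊕ᶠ u·1)` with `σ(e) e = σ(u) u = 1`
and `e − u` a unit, then `ᵗ(σP) H P = G₁ ⊕ᶠ G₂` for some blocks (the two eigenspaces of a unitary element with distinct norm-one eigenvalues are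
`H`-orthogonal: `H_P` commutes with `e·1 ⊕ᶠ u·1`, ★ `eq_finSum_of_commute`). [cite: Rogawski1990, §3.1 p. 19; §3.8 Prop. 3.8.1 p. 30] -/
theorem exists_twistGram_eq_finSum_of_scalar_frame {H : Matrix (Fin (N₁ + N₂)) (Fin (N₁ + N₂)) S} {γ P : GL (Fin (N₁ + N₂)) S} {e u : S}
    (hγ : γ ∈ unitaryGroup σ H)
    (hP : γ.val * P.val = P.val * finSum N₁ N₂ (e • (1 : Matrix (Fin N₁) (Fin N₁) S)) (u • (1 : Matrix (Fin N₂) (Fin N₂) S)))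
    (he : σ e * e = 1) (hu : σ u * u = 1) (heu : IsUnit (e - u)) :
    ∃ (G₁ : Matrix (Fin N₁) (Fin N₁) S) (G₂ : Matrix (Fin N₂) (Fin N₂) S), twistGram σ H P.val = finSum N₁ N₂ G₁ G₂ := by
  set D := finSum N₁ N₂ (e • (1 : Matrix (Fin N₁) (Fin N₁) S)) (u • (1 : Matrix (Fin N₂) (Fin N₂) S)) with hD
  set T := twistGram σ H P.val with hT
  -- invariance of `T` under `D`: `ᵗ(σD) T D = T`
  have hinv : (D.map σ)ᵀ * T * D = T := by
    have h1 : twistGram σ H (γ.val * P.val) = T := twistGram_unitary_mul σ H hγ _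
    rwa [hP, twistGram_mul] at h1
  -- `D ᵗ(σD) = 1`, hence `T D = D T`
  have hDD : D * (D.map σ)ᵀ = 1 := by
    rw [hD, map_transpose_finSum_smul_one, finSum_smul_one_mul_finSum_smul_one, mul_comm e, he, mul_comm u, hu, one_smul, one_smul,
      finSum, fromBlocks_one, reindex_apply, submatrix_one_equiv]
  have hcomm : T * D = D * T := by
    calc T * D = D * (D.map σ)ᵀ * T * D := by rw [hDD, Matrix.one_mul]
      _ = D * ((D.map σ)ᵀ * T * D) := by simp only [Matrix.mul_assoc]
      _ = D * T := by rw [hinv]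
  obtain ⟨G₁, G₂, hG⟩ := eq_finSum_of_commute heu T hcomm
  exact ⟨G₁, G₂, hG⟩

omit σ in
/-- The scalar-block pattern matrix `(e·1₂ 0 x)`: `ι(e·1₂, x) = diag(e, x, e)`. [cite: Rogawski1990, §4.8 Case (a) p. 53] -/
theorem scalar_endoPattern_eq (e x : S) :
    !![(e • (1 : Matrix (Fin 2) (Fin 2) S)) 0 0, 0, (e • (1 : Matrix (Fin 2) (Fin 2) S)) 0 1; 0, x, 0;
        (e • (1 : Matrix (Fin 2) (Fin 2) S)) 1 0, 0, (e • (1 : Matrix (Fin 2) (Fin 2) S)) 1 1] = !![e, 0, 0; 0, x, 0; 0, 0, e] := by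
  simp [Matrix.smul_apply]

omit σ in
/-- The transposition matrix `(e₁ e₃ e₂)` is an involution. [folklore] -/
private theorem swapMatrix_mul_self : (!![1, 0, 0; 0, 0, 1; 0, 1, 0] : Matrix (Fin 3) (Fin 3) S) * !![1, 0, 0; 0, 0, 1; 0, 1, 0] = 1 := by
  rw [Matrix.one_fin_three]
  ext i j; fin_cases i <;> fin_cases j <;> simp

omit σ in
/-- `diag(e, u, e) · (e₁ e₃ e₂) = (e₁ e₃ e₂) · diag(e, e, u)`: the transposition frames the scalar-block pattern. [folklore] -/
private theorem diag_mul_swapMatrix (e u : S) :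
    (!![e, 0, 0; 0, u, 0; 0, 0, e] : Matrix (Fin 3) (Fin 3) S) * !![1, 0, 0; 0, 0, 1; 0, 1, 0] = !![1, 0, 0; 0, 0, 1; 0, 1, 0] * !![e, 0, 0; 0, e, 0; 0, 0, u] := by
  ext i j; fin_cases i <;> fin_cases j <;> simp

omit σ in
/-- `e·1₂ ⊕ᶠ u·1₁ = diag(e, e, u)` as an explicit `3 × 3` matrix. [folklore] -/
private theorem finSum_two_one_smul_one (e u : S) :
    finSum 2 1 (e • (1 : Matrix (Fin 2) (Fin 2) S)) (u • (1 : Matrix (Fin 1) (Fin 1) S)) = !![e, 0, 0; 0, e, 0; 0, 0, u] := by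
  have hs0 : (finSumFinEquiv (m := 2) (n := 1)).symm (0 : Fin 3) = Sum.inl (0 : Fin 2) := by decide
  have hs1 : (finSumFinEquiv (m := 2) (n := 1)).symm (1 : Fin 3) = Sum.inl (1 : Fin 2) := by decide
  have hs2 : (finSumFinEquiv (m := 2) (n := 1)).symm (2 : Fin 3) = Sum.inr (0 : Fin 1) := by decide
  rw [finSum_smul_one_eq_diagonal_elim]
  ext i j; fin_cases i <;> fin_cases j <;> simp [diagonal, hs0, hs1, hs2]

/-- **Determinant bookkeeping**: if `A·x = σ(d)·D₀·d` and `A′·(σ(z) z x) = σ(d′)·D₀·d′` with `x, d, d′, z` units, then `A′ = A · σ(z′) z′` for the unit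
`z′ = d′ d⁻¹ z⁻¹` (same rank-one class ⇒ same rank-two determinant class). [cite: Rogawski1990, §3.8 Prop. 3.8.1 (d) p. 30] -/
theorem exists_eq_mul_norm_of_mul_eq {A A' x D₀ d d' z : S} (hx : IsUnit x) (hd : IsUnit d) (hd' : IsUnit d') (hz : IsUnit z)
    (h1 : A * x = σ d * D₀ * d) (h2 : A' * (σ z * z * x) = σ d' * D₀ * d') :
    ∃ z' : S, IsUnit z' ∧ A' = A * (σ z' * z') := by
  obtain ⟨dinv, hdinv⟩ := hd.exists_right_inv
  obtain ⟨zinv, hzinv⟩ := hz.exists_right_inv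
  have hσd : σ d * σ dinv = 1 := by rw [← map_mul, hdinv, map_one]
  have hσz : σ z * σ zinv = 1 := by rw [← map_mul, hzinv, map_one]
  refine ⟨d' * dinv * zinv, (hd'.mul (IsUnit.of_mul_eq_one_right _ hdinv)).mul (IsUnit.of_mul_eq_one_right _ hzinv), ?_⟩
  -- `A′ (σz z) = A σ(r) r` with `r = d′ dinv`, after cancelling the unit `x`
  have key : A' * (σ z * z) * x = A * (σ (d' * dinv) * (d' * dinv)) * x := by
    have e1 : A' * (σ z * z) * x = σ d' * D₀ * d' := by rw [← h2]; ring
    have e2 : A * (σ (d' * dinv) * (d' * dinv)) * x = σ (d' * dinv) * (d' * dinv) * (A * x) := by ring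
    rw [e1, e2, h1, map_mul]
    linear_combination (-(σ d' * D₀ * d' * (σ d * σ dinv))) * hdinv + (-(σ d' * D₀ * d')) * hσd
  have key' : A' * (σ z * z) = A * (σ (d' * dinv) * (d' * dinv)) := (IsUnit.mul_left_inj hx).1 key
  simp only [map_mul] at key' ⊢
  linear_combination (σ zinv * zinv) * key' - (A' * (z * zinv)) * hσz - A' * hzinv

end Generic

/-! ## §2 The scalar partner on the CM carriers: `κ_v` separates the two classes -/

section CM

variable (L : Type) [Field L] [NumberField L] [IsCMField L] (v : HeightOneSpectrum (𝓞 ↥(maximalRealSubfield L)))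
  (H' : Matrix (Fin 3) (Fin 3) L)
  (a : (UnitaryGroup.cmDatum L 2 (Matrix.of fun i j : Fin 2 => if i.val + j.val + 1 = 2 then (1 : L) else 0)).Local v ×
      (UnitaryGroup.cmDatum L 1 (Matrix.of fun i j : Fin 1 => if i.val + j.val + 1 = 1 then (1 : L) else 0)).Local v)
  (b b' : (UnitaryGroup.cmDatum L 3 H').Local v)

/-- A CM field has a non-zero element negated by complex conjugation (`ζ − ζ̄` for any `ζ` moved by `c ≠ 1`). [cite: Rogawski1990, §1.10] -/
private theorem exists_complexConj_eq_neg_ne_zero₃ : ∃ δ : L, IsCMField.complexConj L δ = -δ ∧ δ ≠ 0 := by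
  obtain ⟨ζ, hζ⟩ := not_forall.1 fun h0 => IsCMField.complexConj_ne_one L (AlgEquiv.ext h0)
  refine ⟨ζ - IsCMField.complexConj L ζ, by rw [map_sub, IsCMField.complexConj_apply_apply, neg_sub], fun h0 => hζ ?_⟩
  rw [sub_eq_zero] at h0
  exact h0.symm

/-- If `p ↔ q` decide the same sign then the signs agree iff `p ↔ q`. [folklore] -/
private theorem ite_one_neg_one_eq_iff₃ (p q : Prop) [Decidable p] [Decidable q] :
    ((if p then (1 : ℤ) else -1) = if q then 1 else -1) ↔ (p ↔ q) := by
  by_cases hp : p <;> by_cases hq : q <;> simp [hp, hq]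

/-- **`σ(e)·e = 1` for the scalar block `γ_H.1 = e·1₂ ∈ U(Φ₂)(L⁺_v)`** (the `(0,1)` entry of `ᵗσ(e·1) Φ₂ (e·1) = Φ₂`, `(Φ₂)₀₁ = 1`).
[cite: Rogawski1990, §4.8 Case (a) p. 53; §4.9 p. 55] -/
theorem conjLocal_mul_self_of_fst_eq_smul_one {e : UnitaryGroup.LocalRing L v}
    (ha : (a.1.val.val : Matrix (Fin 2) (Fin 2) (UnitaryGroup.LocalRing L v)) = e • (1 : Matrix (Fin 2) (Fin 2) _)) :
    UnitaryGroup.conjLocal L (IsCMField.complexConj L) v e * e = 1 := by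
  have hmem := mem_unitaryGroupOfForm_iff.mp a.1.2
  rw [ha, smul_one_eq_diagonal, diagonal_map (map_zero _), diagonal_transpose, adelicForm_map_adeleToLocal] at hmem
  have h01 := congrFun (congrFun hmem 0) 1
  rw [mul_apply, Fin.sum_univ_two, diagonal_mul, diagonal_mul, diagonal_apply_ne _ (by decide : (0 : Fin 2) ≠ 1), diagonal_apply_eq,
    mul_zero, zero_add, Matrix.map_apply, Matrix.of_apply] at h01
  simp only [Fin.val_zero, Fin.val_one, zero_add, Nat.reduceAdd, ↓reduceIte, map_one, mul_one] at h01
  exact h01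

set_option maxHeartbeats 400000 in -- many `GL₃(∏_w L_w)`-level unifications; each is cheap, the sum is not
open scoped Classical in
/-- **`κ_v` SEPARATES THE TWO CLASSES AT THE SCALAR PARTNER** (non-split `v`, one place `w` with `c • w = w`): for `γ_H = (e·1₂, u)` with `(u − e)²` a unit
and two matches `γ′, γ″ ∈ G′_v` of `ι_v(γ_H)`: `κ_v(γ_H, γ″) = κ_v(γ_H, γ′)` **iff** `γ′, γ″` are conjugate in `U(H′_v)(F_v)` — the scalar-block twin of ★
`finKappaAt_eq_iff_isConj` (type (2)).  (⇐) ★ `finKappaAt_eq_of_isConj`; (⇒) both signs read on the `u`-column of the eigenframes `gP₀`, `g′P₀` (★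
`finKappaAt_eq_ite_twistGram_eigenframe`), index two of the norm group turns equal signs into `G″₂ = N(z) G₂` for the rank-one Gram blocks, determinants
turn it into `det G″₁ = det G₁ · N(z′)`, and ★ `exists_unitary_conj_of_det_blocks` conjugates. [cite: Rogawski1990, §3.8 Prop. 3.8.1 (d) p. 30; §4.3 (4.3.2)
p. 43; §8.2 Prop. 8.2.1 (a)(d) pp. 118–122] [cite: LanglandsShelstad1987, §1] [cite: Jacobowitz1962, §3 Thm. 3.1] -/
theorem finKappaAt_eq_iff_isConj_of_fst_eq_smul_one (w : UnitaryGroup.PlacesOver L v) (hw : IsCMField.complexConj L • w.1 = w.1)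
    (h : IsLocalNormPair L H' v a b) (h' : IsLocalNormPair L H' v a b') (hu : IsUnit ((finCharpolyTwo L v a).eval (finGammaTwo L v a)))
    (hH : (((UnitaryGroup.adelicForm L 3 H').map (UnitaryGroup.adeleToLocal L v)).map
      (UnitaryGroup.conjLocal L (IsCMField.complexConj L) v))ᵀ = (UnitaryGroup.adelicForm L 3 H').map (UnitaryGroup.adeleToLocal L v))
    (hHd : IsUnit ((UnitaryGroup.adelicForm L 3 H').map (UnitaryGroup.adeleToLocal L v)).det)
    {e : UnitaryGroup.LocalRing L v} (ha : (a.1.val.val : Matrix (Fin 2) (Fin 2) (UnitaryGroup.LocalRing L v)) = e • (1 : Matrix (Fin 2) (Fin 2) _)) :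
    finKappaAt L v H' a b' = finKappaAt L v H' a b ↔
      IsConj (⟨b.val, b.2⟩ : unitaryGroup (UnitaryGroup.conjLocal L (IsCMField.complexConj L) v)
        ((UnitaryGroup.adelicForm L 3 H').map (UnitaryGroup.adeleToLocal L v))) ⟨b'.val, b'.2⟩ := by
  classical
  obtain ⟨δ, hcδ, hδ⟩ := exists_complexConj_eq_neg_ne_zero₃ L
  haveI : Algebra.IsQuadraticExtension ↥(maximalRealSubfield L) L := IsCMField.isQuadraticExtension L
  have hσσ : ∀ s, UnitaryGroup.conjLocal L (IsCMField.complexConj L) v (UnitaryGroup.conjLocal L (IsCMField.complexConj L) v s) = s :=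
    Liu2021.LemD1OfPlace.conjLocal_conjLocal_apply L v (IsCMField.complexConj L) hcδ hδ
  have hv : Subsingleton (UnitaryGroup.PlacesOver L v) :=
    UnitaryGroup.PlacesOver.subsingleton_of_smul_eq (IsCMField.complexConj L) (IsCMField.complexConj_ne_one L) w hw
  set σ := UnitaryGroup.conjLocal L (IsCMField.complexConj L) v with hσdef
  set Hv := (UnitaryGroup.adelicForm L 3 H').map (UnitaryGroup.adeleToLocal L v) with hHvdef
  set u := finGammaTwo L v a with hudef
  refine ⟨fun hκ => ?_, fun hc => ?_⟩
  swap
  · -- (⇐) `κ_v(γ_H, ·)` is a class function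
    obtain ⟨y, hy⟩ := isConj_iff.1 hc
    refine finKappaAt_eq_of_isConj L v H' a b h (isConj_iff.2 ⟨⟨y.val, y.2⟩, Subtype.ext ?_⟩)
    exact congrArg Subtype.val hy
  have he1 : σ e * e = 1 := conjLocal_mul_self_of_fst_eq_smul_one L v a ha
  have hu1 : σ u * u = 1 := conjLocal_finGammaTwo_mul_finGammaTwo L v a
  have heu : IsUnit (e - u) := by
    have h2 : IsUnit ((u - e) ^ 2) := by rw [← eval_finCharpolyTwo_of_fst_eq_smul_one L v a ha]; exact hu
    rw [← neg_sub]
    exact ((isUnit_pow_iff two_ne_zero).1 h2).neg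
  -- `ι_v(γ_H) = diag(e, u, e)` and its transposition frame
  set γ₀ : GL (Fin 3) (UnitaryGroup.LocalRing L v) := (endoEmbLocal L v a).val with hγ₀
  have hι : (γ₀.val : Matrix (Fin 3) (Fin 3) (UnitaryGroup.LocalRing L v)) = !![e, 0, 0; 0, u, 0; 0, 0, e] := by
    rw [hγ₀, coe_endoEmbLocal, coe_endoGL_eq, ha]
    exact scalar_endoPattern_eq e u
  set P₀m : Matrix (Fin 3) (Fin 3) (UnitaryGroup.LocalRing L v) := !![1, 0, 0; 0, 0, 1; 0, 1, 0] with hP₀m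
  have hP₀P₀ : P₀m * P₀m = 1 := swapMatrix_mul_self
  set P₀ : GL (Fin 3) (UnitaryGroup.LocalRing L v) := ⟨P₀m, P₀m, hP₀P₀, hP₀P₀⟩ with hP₀
  have hP₀val : P₀.val = P₀m := rfl
  -- the scalar-block frame `ι(γ_H) P₀ = P₀ (e·1 ⊕ᶠ u·1)`
  set D := finSum 2 1 (e • (1 : Matrix (Fin 2) (Fin 2) (UnitaryGroup.LocalRing L v))) (u • (1 : Matrix (Fin 1) (Fin 1) (UnitaryGroup.LocalRing L v)))
    with hD
  set u' : Fin 3 → UnitaryGroup.LocalRing L v :=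
    fun i => Sum.elim (fun _ => e) (fun _ => u) ((finSumFinEquiv (m := 2) (n := 1)).symm i) with hu'
  have hDdiag : D = diagonal u' := finSum_smul_one_eq_diagonal_elim e u
  set j : Fin 3 := finSumFinEquiv (m := 2) (n := 1) (Sum.inr 0) with hjdef
  have hDexp : D = !![e, 0, 0; 0, e, 0; 0, 0, u] := finSum_two_one_smul_one e u
  have hframe : γ₀.val * P₀.val = P₀.val * D := by
    rw [hι, hP₀val, hDexp]
    exact diag_mul_swapMatrix e u
  obtain ⟨g, hg⟩ := isConj_iff.1 ((isLocalNormPair_iff L H' v a b).1 h)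
  obtain ⟨g', hg'⟩ := isConj_iff.1 ((isLocalNormPair_iff L H' v a b').1 h')
  rw [← hγ₀] at hg hg'
  have hgγ : g.val * γ₀.val = b.val.val * g.val := by
    rw [← Units.val_mul, ← Units.val_mul, ← hg, inv_mul_cancel_right]
  have hg'γ : g'.val * γ₀.val = b'.val.val * g'.val := by
    rw [← Units.val_mul, ← Units.val_mul, ← hg', inv_mul_cancel_right]
  -- `ι(γ_H)` is unitary for the transported forms `H′_g`, `H′_{g′}`; their Gram matrices in the frame are block diagonal (§1)
  have hγ₀g : γ₀ ∈ unitaryGroup σ (twistGram σ Hv g.val) := by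
    rw [Literature.AlgebraicGeometry.ShimuraVarieties.mem_unitaryGroup_iff, ← twistGram_mul, hgγ, twistGram_unitary_mul σ Hv b.2]
  have hγ₀g' : γ₀ ∈ unitaryGroup σ (twistGram σ Hv g'.val) := by
    rw [Literature.AlgebraicGeometry.ShimuraVarieties.mem_unitaryGroup_iff, ← twistGram_mul, hg'γ, twistGram_unitary_mul σ Hv b'.2]
  obtain ⟨G₁, G₂, hGP⟩ := exists_twistGram_eq_finSum_of_scalar_frame (N₁ := 2) (N₂ := 1) σ hγ₀g hframe he1 hu1 heu
  obtain ⟨G'₁, G'₂, hG'P⟩ := exists_twistGram_eq_finSum_of_scalar_frame (N₁ := 2) (N₂ := 1) σ hγ₀g' hframe he1 hu1 heu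
  -- the signs read on the `u`-column `j` of the eigenframes `g P₀`, `g′ P₀`
  have hPg : (b.val.val : Matrix (Fin 3) (Fin 3) (UnitaryGroup.LocalRing L v)) * (g * P₀).val = (g * P₀).val * diagonal u' := by
    rw [Units.val_mul, ← Matrix.mul_assoc, ← hgγ, Matrix.mul_assoc, hframe, ← Matrix.mul_assoc, hDdiag]
  have hj : u' j = finGammaTwo L v a := by
    simp only [hu', hjdef, Equiv.symm_apply_apply, Sum.elim_inr, hudef]
  have h₂ : (g' * g⁻¹) * b.val * (g' * g⁻¹)⁻¹ = b'.val := by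
    rw [← hg, ← hg', _root_.mul_inv_rev, inv_inv]
    simp only [mul_assoc, inv_mul_cancel_left]
  have hκb := finKappaAt_eq_ite_twistGram_eigenframe L v H' a b hv h hu hPg hj
  have hκb' := finKappaAt_eq_ite_twistGram_mul_eigenframe L v H' a b b' hv h hu hPg hj h₂
  have hval : (g' * g⁻¹).val * (g * P₀).val = g'.val * P₀.val := by
    rw [← Units.val_mul, ← Units.val_mul, mul_assoc, inv_mul_cancel_left]
  have hjj : twistGram σ Hv (g * P₀).val j j = G₂ 0 0 := by
    rw [Units.val_mul, twistGram_mul, ← twistGram_def, hGP, hjdef, finSum_apply_inr]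
  have hjj' : twistGram σ Hv ((g' * g⁻¹).val * (g * P₀).val) j j = G'₂ 0 0 := by
    rw [hval, twistGram_mul, ← twistGram_def, hG'P, hjdef, finSum_apply_inr]
  rw [hjj] at hκb
  rw [hjj'] at hκb'
  have hdT : G₁.det * G₂ 0 0 = σ (g.val * P₀.val).det * Hv.det * (g.val * P₀.val).det := by
    rw [← Matrix.det_fin_one G₂, ← det_finSum, ← hGP, twistGram_def σ (twistGram σ Hv g.val), ← twistGram_mul, det_twistGram]
  have hdT' : G'₁.det * G'₂ 0 0 = σ (g'.val * P₀.val).det * Hv.det * (g'.val * P₀.val).det := by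
    rw [← Matrix.det_fin_one G'₂, ← det_finSum, ← hG'P, twistGram_def σ (twistGram σ Hv g'.val), ← twistGram_mul, det_twistGram]
  have hdg : IsUnit (g.val * P₀.val).det := by rw [← Units.val_mul]; exact Matrix.isUnits_det_units _
  have hdg' : IsUnit (g'.val * P₀.val).det := by rw [← Units.val_mul]; exact Matrix.isUnits_det_units _
  have hG₂u : IsUnit (G₂ 0 0) :=
    isUnit_of_mul_isUnit_right (hdT ▸ ((hdg.map σ).mul hHd).mul hdg)
  have hG'₂u : IsUnit (G'₂ 0 0) :=
    isUnit_of_mul_isUnit_right (hdT' ▸ ((hdg'.map σ).mul hHd).mul hdg')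
  have hherm : ∀ (M : Matrix (Fin 3) (Fin 3) (UnitaryGroup.LocalRing L v)) (i : Fin 3), σ (twistGram σ Hv M i i) = twistGram σ Hv M i i :=
    fun M i => by
      have hc := congrFun (congrFun (conjTranspose_twistGram σ Hv hσσ hH M) i) i
      rwa [transpose_apply, map_apply] at hc
  have hG₂σ : σ (G₂ 0 0) = G₂ 0 0 := by
    rw [← hjj, Units.val_mul]
    exact hherm _ _
  have hG'₂σ : σ (G'₂ 0 0) = G'₂ 0 0 := by
    rw [← hjj', hval]
    exact hherm _ _
  rw [hκb, hκb', ite_one_neg_one_eq_iff₃] at hκ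
  have hnorm : ∃ z : UnitaryGroup.LocalRing L v, IsUnit z ∧ G'₂ 0 0 = σ z * z * G₂ 0 0 := by
    rw [exists_norm_mul_iff_norm_tests_iff L v (IsCMField.complexConj L) hcδ hδ w hw hG₂σ hG₂u hG'₂σ hG'₂u (map_one σ) isUnit_one]
    refine Iff.trans ?_ (hκ.trans ?_)
    · exact exists_congr fun z => and_congr_right fun _ => by rw [mul_one, mul_comm (σ z)]
    · exact exists_congr fun z => and_congr_right fun _ => by rw [mul_one, mul_comm (σ z)]
  obtain ⟨z, hzu, hz⟩ := hnorm
  rw [hz] at hdT'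
  have hdet₁ : ∃ z₁ : UnitaryGroup.LocalRing L v, IsUnit z₁ ∧ G'₁.det = G₁.det * (σ z₁ * z₁) :=
    exists_eq_mul_norm_of_mul_eq σ hG₂u hdg hdg' hzu hdT hdT'
  obtain ⟨uu, huu, hconj⟩ := exists_unitary_conj_of_det_blocks L v (IsCMField.complexConj L) hcδ hδ w hw hH hHd hg hg' hframe hGP hG'P hdet₁
  refine isConj_iff.2 ⟨(⟨uu, huu⟩ : unitaryGroup σ Hv)⁻¹, Subtype.ext ?_⟩
  show uu⁻¹ * b.val * uu⁻¹⁻¹ = b'.val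
  rw [inv_inv, ← hconj, mul_assoc uu, inv_mul_cancel_left, inv_mul_cancel_right]

/-- **`κ_v(γ_H, ε′) = −κ_v(γ_H, ε)` AT THE SCALAR PARTNER**: two matches `γ′, γ″` of `ι_v(γ_H)`, `γ_H = (e·1₂, u)`, `(u − e)²` a unit, which are NOT
conjugate in `U(H′_v)(F_v)` carry opposite signs (`κ_v = ±1` by ★ `finKappaAt_eq_one_or_eq_neg_one_of_isUnit`, and equal signs would conjugate them).
[cite: Rogawski1990, §3.8 Prop. 3.8.1 (d) p. 30; §4.3 (4.3.2) p. 43; §8.2 Prop. 8.2.1 (a)(d) pp. 118–122] [cite: Kottwitz1986, §7] -/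
theorem finKappaAt_eq_neg_of_not_isConj_of_fst_eq_smul_one (w : UnitaryGroup.PlacesOver L v) (hw : IsCMField.complexConj L • w.1 = w.1)
    (h : IsLocalNormPair L H' v a b) (h' : IsLocalNormPair L H' v a b') (hu : IsUnit ((finCharpolyTwo L v a).eval (finGammaTwo L v a)))
    (hH : (((UnitaryGroup.adelicForm L 3 H').map (UnitaryGroup.adeleToLocal L v)).map
      (UnitaryGroup.conjLocal L (IsCMField.complexConj L) v))ᵀ = (UnitaryGroup.adelicForm L 3 H').map (UnitaryGroup.adeleToLocal L v))
    (hHd : IsUnit ((UnitaryGroup.adelicForm L 3 H').map (UnitaryGroup.adeleToLocal L v)).det)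
    {e : UnitaryGroup.LocalRing L v} (ha : (a.1.val.val : Matrix (Fin 2) (Fin 2) (UnitaryGroup.LocalRing L v)) = e • (1 : Matrix (Fin 2) (Fin 2) _))
    (hne : ¬ IsConj (⟨b.val, b.2⟩ : unitaryGroup (UnitaryGroup.conjLocal L (IsCMField.complexConj L) v)
        ((UnitaryGroup.adelicForm L 3 H').map (UnitaryGroup.adeleToLocal L v))) ⟨b'.val, b'.2⟩) :
    finKappaAt L v H' a b' = -finKappaAt L v H' a b := by
  have hneq : finKappaAt L v H' a b' ≠ finKappaAt L v H' a b := fun heq =>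
    hne ((finKappaAt_eq_iff_isConj_of_fst_eq_smul_one L v H' a b b' w hw h h' hu hH hHd ha).1 heq)
  rcases finKappaAt_eq_one_or_eq_neg_one_of_isUnit L v H' a b h hu with h1 | h1 <;>
    rcases finKappaAt_eq_one_or_eq_neg_one_of_isUnit L v H' a b' h' hu with h2 | h2
  · exact absurd (h2.trans h1.symm) hneq
  · rw [h1, h2]
  · rw [h1, h2]; norm_num
  · exact absurd (h2.trans h1.symm) hneq

open scoped Classical in
/-- **`Δ‴_v(γ_H, ε′) = −Δ‴_v(γ_H, ε)` AT THE SCALAR PARTNER** — Rogawski's explicit factor `Δ‴_v = τ_v · D_{G∕H,v} · κ_v` (★ `finExplicitDelta`) takes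
OPPOSITE values on the two non-conjugate matches of `ι_v(e·1₂, u)`: `τ_v`, `D_v` depend on `γ_H` alone and `κ_v` flips.  The transfer-factor input of the
`ε′`-side of Langlands–Shelstad descent at the `(G,H)`-regular singular point (Rogawski's Prop. 8.2.1 (a)(d) ⟸ 8.1.3).
[cite: Rogawski1990, §4.9 p. 55; §4.3 (4.3.2) p. 43; §8.2 Prop. 8.2.1 (a)(d) pp. 118–122] [cite: LanglandsShelstad1987, §1] -/
theorem finExplicitDelta_eq_neg_of_not_isConj_of_fst_eq_smul_one (μ : HeckeCharacter L)
    (w : UnitaryGroup.PlacesOver L v) (hw : IsCMField.complexConj L • w.1 = w.1)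
    (h : IsLocalNormPair L H' v a b) (h' : IsLocalNormPair L H' v a b') (hu : IsUnit ((finCharpolyTwo L v a).eval (finGammaTwo L v a)))
    (hH : (((UnitaryGroup.adelicForm L 3 H').map (UnitaryGroup.adeleToLocal L v)).map
      (UnitaryGroup.conjLocal L (IsCMField.complexConj L) v))ᵀ = (UnitaryGroup.adelicForm L 3 H').map (UnitaryGroup.adeleToLocal L v))
    (hHd : IsUnit ((UnitaryGroup.adelicForm L 3 H').map (UnitaryGroup.adeleToLocal L v)).det)
    {e : UnitaryGroup.LocalRing L v} (ha : (a.1.val.val : Matrix (Fin 2) (Fin 2) (UnitaryGroup.LocalRing L v)) = e • (1 : Matrix (Fin 2) (Fin 2) _))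
    (hne : ¬ IsConj (⟨b.val, b.2⟩ : unitaryGroup (UnitaryGroup.conjLocal L (IsCMField.complexConj L) v)
        ((UnitaryGroup.adelicForm L 3 H').map (UnitaryGroup.adeleToLocal L v))) ⟨b'.val, b'.2⟩) :
    finExplicitDelta L v H' a μ b' = -finExplicitDelta L v H' a μ b := by
  rw [finExplicitDelta_of_isLocalNormPair L v H' a μ h, finExplicitDelta_of_isLocalNormPair L v H' a μ h',
    finKappaAt_eq_neg_of_not_isConj_of_fst_eq_smul_one L v H' a b b' w hw h h' hu hH hHd ha hne, Int.cast_neg]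
  ring

open scoped Classical in
/-- **The same in the currency of the finite collection `(Δ‴_v)_v`** (★ `finExplicitCollection`, the `Δ` slot read by the N6nsGerm stubs through
`((finExplicitCollection L H′ μ hl hr) v).Δ`): `Δ_v(γ_H, ε′) = −Δ_v(γ_H, ε)` at the scalar partner. [cite: Rogawski1990, §4.9 p. 55; §4.3 (4.3.2) p. 43] -/
theorem finExplicitCollection_Δ_eq_neg_of_not_isConj_of_fst_eq_smul_one (μ : HeckeCharacter L)
    (hl : ∀ (v : HeightOneSpectrum (𝓞 ↥(maximalRealSubfield L)))
      (a : (UnitaryGroup.cmDatum L 2 (Matrix.of fun i j : Fin 2 => if i.val + j.val + 1 = 2 then (1 : L) else 0)).Local v ×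
      (UnitaryGroup.cmDatum L 1 (Matrix.of fun i j : Fin 1 => if i.val + j.val + 1 = 1 then (1 : L) else 0)).Local v)
      (b : (UnitaryGroup.cmDatum L 3 H').Local v)
      (x : (UnitaryGroup.cmDatum L 2 (Matrix.of fun i j : Fin 2 => if i.val + j.val + 1 = 2 then (1 : L) else 0)).Local v ×
      (UnitaryGroup.cmDatum L 1 (Matrix.of fun i j : Fin 1 => if i.val + j.val + 1 = 1 then (1 : L) else 0)).Local v),
      finExplicitDelta L v H' (x * a * x⁻¹) μ b = finExplicitDelta L v H' a μ b)
    (hr : ∀ (v : HeightOneSpectrum (𝓞 ↥(maximalRealSubfield L)))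
      (a : (UnitaryGroup.cmDatum L 2 (Matrix.of fun i j : Fin 2 => if i.val + j.val + 1 = 2 then (1 : L) else 0)).Local v ×
      (UnitaryGroup.cmDatum L 1 (Matrix.of fun i j : Fin 1 => if i.val + j.val + 1 = 1 then (1 : L) else 0)).Local v)
      (b y : (UnitaryGroup.cmDatum L 3 H').Local v),
      finExplicitDelta L v H' a μ (y * b * y⁻¹) = finExplicitDelta L v H' a μ b)
    (w : UnitaryGroup.PlacesOver L v) (hw : IsCMField.complexConj L • w.1 = w.1)
    (h : IsLocalNormPair L H' v a b) (h' : IsLocalNormPair L H' v a b') (hu : IsUnit ((finCharpolyTwo L v a).eval (finGammaTwo L v a)))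
    (hH : (((UnitaryGroup.adelicForm L 3 H').map (UnitaryGroup.adeleToLocal L v)).map
      (UnitaryGroup.conjLocal L (IsCMField.complexConj L) v))ᵀ = (UnitaryGroup.adelicForm L 3 H').map (UnitaryGroup.adeleToLocal L v))
    (hHd : IsUnit ((UnitaryGroup.adelicForm L 3 H').map (UnitaryGroup.adeleToLocal L v)).det)
    {e : UnitaryGroup.LocalRing L v} (ha : (a.1.val.val : Matrix (Fin 2) (Fin 2) (UnitaryGroup.LocalRing L v)) = e • (1 : Matrix (Fin 2) (Fin 2) _))
    (hne : ¬ IsConj (⟨b.val, b.2⟩ : unitaryGroup (UnitaryGroup.conjLocal L (IsCMField.complexConj L) v)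
        ((UnitaryGroup.adelicForm L 3 H').map (UnitaryGroup.adeleToLocal L v))) ⟨b'.val, b'.2⟩) :
    ((finExplicitCollection L H' μ hl hr) v).Δ a b' = -((finExplicitCollection L H' μ hl hr) v).Δ a b := by
  rw [finExplicitCollection_Δ, finExplicitCollection_Δ]
  exact finExplicitDelta_eq_neg_of_not_isConj_of_fst_eq_smul_one L v H' a b b' μ w hw h h' hu hH hHd ha hne

end CM

end Literature.NumberTheory.Rogawski1990
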